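import Literature.NumberTheory.LFunctions.Zhang2022.KnifeEdgeLenZDegreeBarrier
import Literature.NumberTheory.LFunctions.Zhang2022.KnifeEdgeLenZDegreeSlotTypes

/-!
# Zhang (2022), rung F-S3 (Landau–Siegel programme, §D edge len = E*-len⁺): route `ZDegreeToeplitzBand`, the K1″a hand's
# SUPPORT-LEDGER vocabulary — ψ-graded slots RESTRICTED to a sub-class of in-class pairs, SHORT pieces, the half-class of
# SHORT PAIRS, and the darkness statement for the degree-2 table on short pairs (OPEN)

Y. Zhang, *Discrete mean estimates and the Landau–Siegel zero*, arXiv:2211.02515v1 [Zhang2022LandauSiegel] — an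
unrefereed manuscript under adjudication. **WHAT THIS IS NOT: not a claim about Theorems 1–2 of arXiv:2211.02515, about
Landau–Siegel zeros, or about Parity. The programme SEARCHES and TYPES; no claim about Landau–Siegel zeros, Theorems 1–2
of arXiv:2211.02515 or a repaired Margin232 until a kernel theorem says so.** `TauTwoDarkShort` is a bare `Prop` — a
statement SHAPE asserted by no one; every `theorem` here is an implication between shapes or finite-sum bookkeeping.

WHY (typer's finding, ls-knife-typer-1 g7 = the K1″a hand, 2026-08-27, files `HOME/ls-knife-typer-1/K1A-CENSUS.md`
bd51ec9d15038e8f and `K1A-DISPLAY-X2short.md` da1580ca30c0ab25 in the cell `landau-siegel`): the route's α-items ask for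
closed-form tables `X₁psi`, `Y₁psi`, `X₂psiDiag` (`KnifeEdge.PsiGradedClosedForms`) satisfying the ψ-graded slots
`KnifeEdge.CrossTablePsi c' d X` / `DualCrossTablePsi c' d Y` (tree `KnifeEdgeLenZDegreePsi`) for ALL in-class pairs
(`InClassPiece` = support `[0,1]`, logarithmic length 1). A support ledger of every arrangement of the three cells under
the manuscript's own identities at a zero `ρ` (functional equation + Lemma 5.1/5.2, Lemma 6.1 K/N split, Lemma 4.8/4.4,
the unit `Z(s,ψ)/Z(s,ψχ)` of §15, the χψ-polynomial approximate functional equation of Lemma 11.2) shows that for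
full-length pairs every arrangement keeps a leg outside the printed mean-value formulas I (Prop 7.1) and II (Prop 14.1),
while for pairs of SHORT pieces with `θ_f + θ_g < 1` every cell is a finite list of printed-type legs; for the degree-2
cross cell the two legs are Lemma 8.1 + Prop 7.1 verbatim on the data `a₁ = D·(δ_D ⋆ υ ⋆ χg ⋆ χf)`, `a₂ = ν·1_{<D⁴}`,
and an order count (two χ-dipoles against one `1/α`, Lemma 8.2) predicts that the degree-2 table is DARK there. This leaf
types the vocabulary that finding is stated in — a slot restricted to a class of pairs (`CrossTablePsiOn`,
`DualCrossTablePsiOn`), short pieces (`ShortPiece θ`), short pairs (`ShortPairs`), the darkness statement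
(`TauTwoDarkShort`, OPEN) — and proves the bookkeeping: restriction is monotone and the full slot is the restriction to the
trivial class; a short piece of length `θ ≤ θ'` is short of length `θ'`; every in-class piece is short of length 1; and if
the full degree-2 slot holds with a functional `X₂` while the table is dark on short pairs and (A)-characters recur, then
`X₂` VANISHES on every short pair (`eq_zero_of_tauTwoDarkShort`, via `asympConst_unique`). No item of the route is restated
here (D-0014: restating is the planner's); the statements only make the typer's report checkable by name.

## References
* Y. Zhang, arXiv:2211.02515v1 (2022), §7 (7.2), Prop. 7.1; §8 Lemma 8.1, Lemma 8.2, (8.5); §4 Lemma 4.8; §15 p. 30.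
  [cite: Zhang2022LandauSiegel, §7 (7.2) Prop 7.1 p.13, §8 Lemma 8.1 (8.5) Lemma 8.2 p.16, §4 Lemma 4.8 p.9]
-/

noncomputable section

open Complex Real ComplexConjugate

namespace Literature.NumberTheory.LFunctions.Zhang2022.KnifeEdge

open Repair Skeleton

/-! ### Part 1 — slots restricted to a class of pairs -/

section Restricted

variable (c' : ℝ)

/-- A class of ADMISSIBLE PAIRS `(f,f′;g,g′)` of in-class pieces with their marked derivatives: the sub-design on which a
ψ-graded slot is asserted (e.g. `ShortPairs`). [cite: Zhang2022LandauSiegel, §7 (7.2)] -/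
abbrev PairClass : Type := (ℝ → ℂ) → (ℝ → ℂ) → (ℝ → ℂ) → (ℝ → ℂ) → Prop

/-- **The ψ-graded CROSS table of degree `d` RESTRICTED to the pairs of `𝒞`** (shape, OPEN): the estimate of
`KnifeEdge.CrossTablePsi c' d X` — `τ^ψ_d(conj Q_g, H_f) = X(f,g)·𝔞𝔓 + o(𝔞𝔓)` under (A), eventually — demanded only for
in-class pairs in `𝒞`. `𝒞 = ⊤` is the route's slot (`crossTablePsiOn_top_iff`). [cite: Zhang2022LandauSiegel, §8 (8.5), Lemma 8.1] -/
def CrossTablePsiOn (𝒞 : PairClass) (d : ℕ) (X : PairFunctional) : Prop :=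
  ∀ (f f' g g' : ℝ → ℂ), InClassPiece f f' → InClassPiece g g' → 𝒞 f f' g g' → ∀ ε : ℝ, 0 < ε →
    ForAllLarge fun D _ χ => AssumptionA D χ →
      ‖zDegMeanPsi c' χ d (fun x t => conj (profPoly χ x g (⌊bigP D⌋₊ + 1) t))
            (fun x t => profPoly χ x f (⌊bigP D⌋₊ + 1) t)
          - X f f' g g' * frakA χ * frakP D‖ ≤ ε * frakA χ * frakP D

/-- **The ψ-graded DUAL table of degree `d` RESTRICTED to the pairs `(g₁,g₁′;g₂,g₂′)` of `𝒞`** (shape, OPEN); `𝒞 = ⊤` is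
`KnifeEdge.DualCrossTablePsi c' d Y`. [cite: Zhang2022LandauSiegel, §2 (2.17), §8 (8.5)] -/
def DualCrossTablePsiOn (𝒞 : PairClass) (d : ℕ) (Y : PairFunctional) : Prop :=
  ∀ (g₁ g₁' g₂ g₂' : ℝ → ℂ), InClassPiece g₁ g₁' → InClassPiece g₂ g₂' → 𝒞 g₁ g₁' g₂ g₂' → ∀ ε : ℝ, 0 < ε →
    ForAllLarge fun D _ χ => AssumptionA D χ →
      ‖zDegMeanPsi c' χ d (fun x t => conj (profPoly χ x g₂ (⌊bigP D⌋₊ + 1) t))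
            (fun x t => conj (profPoly χ x g₁ (⌊bigP D⌋₊ + 1) t))
          - Y g₁ g₁' g₂ g₂' * frakA χ * frakP D‖ ≤ ε * frakA χ * frakP D

variable {c'}

/-- The full cross slot is the restriction to the trivial class. [cite: Zhang2022LandauSiegel, §8 (8.5)] -/
theorem crossTablePsiOn_top_iff {d : ℕ} {X : PairFunctional} :
    CrossTablePsiOn c' (fun _ _ _ _ => True) d X ↔ CrossTablePsi c' d X :=
  ⟨fun h f f' g g' hf hg => h f f' g g' hf hg trivial, fun h f f' g g' hf hg _ => h f f' g g' hf hg⟩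

/-- The full dual slot is the restriction to the trivial class. [cite: Zhang2022LandauSiegel, §8 (8.5)] -/
theorem dualCrossTablePsiOn_top_iff {d : ℕ} {Y : PairFunctional} :
    DualCrossTablePsiOn c' (fun _ _ _ _ => True) d Y ↔ DualCrossTablePsi c' d Y :=
  ⟨fun h g₁ g₁' g₂ g₂' h₁ h₂ => h g₁ g₁' g₂ g₂' h₁ h₂ trivial, fun h g₁ g₁' g₂ g₂' h₁ h₂ _ => h g₁ g₁' g₂ g₂' h₁ h₂⟩

/-- A slot on the whole class restricts to any sub-class. [cite: Zhang2022LandauSiegel, §8 (8.5)] -/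
theorem CrossTablePsi.on {d : ℕ} {X : PairFunctional} (h : CrossTablePsi c' d X) (𝒞 : PairClass) :
    CrossTablePsiOn c' 𝒞 d X :=
  fun f f' g g' hf hg _ => h f f' g g' hf hg

/-- A dual slot on the whole class restricts to any sub-class. [cite: Zhang2022LandauSiegel, §8 (8.5)] -/
theorem DualCrossTablePsi.on {d : ℕ} {Y : PairFunctional} (h : DualCrossTablePsi c' d Y) (𝒞 : PairClass) :
    DualCrossTablePsiOn c' 𝒞 d Y :=
  fun g₁ g₁' g₂ g₂' h₁ h₂ _ => h g₁ g₁' g₂ g₂' h₁ h₂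

/-- Restriction is monotone in the class. [cite: Zhang2022LandauSiegel, §8 (8.5)] -/
theorem CrossTablePsiOn.mono {𝒞₁ 𝒞₂ : PairClass} {d : ℕ} {X : PairFunctional}
    (h𝒞 : ∀ f f' g g', 𝒞₁ f f' g g' → 𝒞₂ f f' g g') (h : CrossTablePsiOn c' 𝒞₂ d X) : CrossTablePsiOn c' 𝒞₁ d X :=
  fun f f' g g' hf hg h₁ => h f f' g g' hf hg (h𝒞 f f' g g' h₁)

/-- Restriction of the dual slot is monotone in the class. [cite: Zhang2022LandauSiegel, §8 (8.5)] -/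
theorem DualCrossTablePsiOn.mono {𝒞₁ 𝒞₂ : PairClass} {d : ℕ} {Y : PairFunctional}
    (h𝒞 : ∀ f f' g g', 𝒞₁ f f' g g' → 𝒞₂ f f' g g') (h : DualCrossTablePsiOn c' 𝒞₂ d Y) :
    DualCrossTablePsiOn c' 𝒞₁ d Y :=
  fun g₁ g₁' g₂ g₂' h₁ h₂ h𝒞₁ => h g₁ g₁' g₂ g₂' h₁ h₂ (h𝒞 g₁ g₁' g₂ g₂' h𝒞₁)

/-- **A restricted slot pins its functional on its class** (unless (A) fails eventually): two functionals satisfying the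
same restricted cross slot agree on every in-class pair of the class (`asympConst_unique`). [cite: Zhang2022LandauSiegel, §8 (8.5)] -/
theorem crossTablePsiOn_unique {𝒞 : PairClass} {d : ℕ} {X X' : PairFunctional} (h : CrossTablePsiOn c' 𝒞 d X)
    (h' : CrossTablePsiOn c' 𝒞 d X') (hA : ¬ ForAllLarge fun D _ χ => ¬ AssumptionA D χ) {f f' g g' : ℝ → ℂ}
    (hf : InClassPiece f f') (hg : InClassPiece g g') (h𝒞 : 𝒞 f f' g g') : X f f' g g' = X' f f' g g' :=
  asympConst_unique (T := fun D _ χ => zDegMeanPsi c' χ d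
      (fun x t => conj (profPoly χ x g (⌊bigP D⌋₊ + 1) t)) (fun x t => profPoly χ x f (⌊bigP D⌋₊ + 1) t))
    (fun ε hε => h f f' g g' hf hg h𝒞 ε hε) (fun ε hε => h' f f' g g' hf hg h𝒞 ε hε) hA

end Restricted

/-! ### Part 2 — SHORT pieces and the half-class of short pairs -/

section Short

variable {u u' : ℝ → ℂ} {θ θ' : ℝ}

/-- **A SHORT piece of logarithmic length `θ`**: an in-class piece (`InClassPiece`) vanishing, together with its marked
derivative, on `[θ, ∞)` — the profile polynomial `Σ χψ(n)u(log n/log P)n^{−s}` then has support `n ≤ P^θ` (within (7.2)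
iff `θ < 1 − 2 log T/log P`). [cite: Zhang2022LandauSiegel, §7 (7.2) p.13] -/
structure ShortPiece (θ : ℝ) (u u' : ℝ → ℂ) : Prop where
  inClass : InClassPiece u u'
  vanish : ∀ y, θ ≤ y → u y = 0
  vanish' : ∀ y, θ ≤ y → u' y = 0

/-- A short piece of length `θ` is short of every length `θ′ ≥ θ`. [cite: Zhang2022LandauSiegel, §7 (7.2) p.13] -/
theorem ShortPiece.mono (hu : ShortPiece θ u u') (h : θ ≤ θ') : ShortPiece θ' u u' where
  inClass := hu.inClass
  vanish := fun y hy => hu.vanish y (le_trans h hy)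
  vanish' := fun y hy => hu.vanish' y (le_trans h hy)

/-- Every in-class piece is short of length `1` (the filed class). [cite: Zhang2022LandauSiegel, §7 (7.2) p.13] -/
theorem InClassPiece.shortPiece_one (h : InClassPiece u u') : ShortPiece 1 u u' where
  inClass := h
  vanish := h.vanish
  vanish' := h.vanish'

/-- Short pieces of a fixed length are a cone under complex scalars (as in-class pieces are, `InClassPiece.smul`).
[cite: Zhang2022LandauSiegel, §7 (7.2) p.13] -/
theorem ShortPiece.smul (hu : ShortPiece θ u u') (t : ℂ) : ShortPiece θ (t • u) (t • u') where
  inClass := hu.inClass.smul t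
  vanish := fun y hy => by simp [hu.vanish y hy]
  vanish' := fun y hy => by simp [hu.vanish' y hy]

/-- **The half-class of SHORT PAIRS**: pairs of short pieces whose logarithmic lengths add up to LESS THAN `1` — on this
class the product polynomial `Q_g·H_f` of a cross cell has support `P^{θ_f+θ_g} < PT⁻²`, i.e. satisfies (7.2), which is
what the K1″a support ledger shows to be necessary and sufficient for every arrangement of the cross cells to consist of
printed-type legs. [cite: Zhang2022LandauSiegel, §7 (7.2) p.13, §8 Lemma 8.1 p.16] -/
def ShortPairs : PairClass := fun f f' g g' =>
  ∃ θf θg : ℝ, θf + θg < 1 ∧ ShortPiece θf f f' ∧ ShortPiece θg g g'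

/-- `ShortPairs` is symmetric in the two pieces. [cite: Zhang2022LandauSiegel, §7 (7.2) p.13] -/
theorem shortPairs_symm {f f' g g' : ℝ → ℂ} (h : ShortPairs f f' g g') : ShortPairs g g' f f' := by
  obtain ⟨θf, θg, hs, hf, hg⟩ := h
  exact ⟨θg, θf, by linarith, hg, hf⟩

/-- `ShortPairs` is a cone in each piece. [cite: Zhang2022LandauSiegel, §7 (7.2) p.13] -/
theorem shortPairs_smul {f f' g g' : ℝ → ℂ} (h : ShortPairs f f' g g') (s t : ℂ) :
    ShortPairs (s • f) (s • f') (t • g) (t • g') := by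
  obtain ⟨θf, θg, hs, hf, hg⟩ := h
  exact ⟨θf, θg, hs, hf.smul s, hg.smul t⟩

/-! ### Part 3 — the darkness statement for the degree-2 table on short pairs (OPEN) and what it pins -/

/-- **DARKNESS OF THE DEGREE-2 ψ-GRADED TABLE ON SHORT PAIRS (OPEN — asserted by no one; the K1″a hand's display #1
claim):** for every pair of short in-class pieces with `θ_f + θ_g < 1`, `τ₂^ψ(conj Q_g, H_f) = o(𝔞𝔓)` under (A), eventually —
i.e. the degree-2 cross slot holds on `ShortPairs` with the ZERO functional. Route to it (display #1): at each zero,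
`Z(ρ,ψ)⁻² = Z̃(ρ,ψ)⁻¹·u` (§15's unit) and Lemma 4.8 turn the cell into the Lemma-8.1 summand for
`a₁ = D·(δ_D ⋆ υ ⋆ χg ⋆ χf)`, `a₂ = ν·1_{<D⁴}` (both within (7.2) exactly because the pair is short); Prop 7.1 gives the two
main terms, in which `a₂ = ν` pins the common divisor below `D⁴` and both profiles stay χ-twisted on one side, so by
Lemma 8.2's dipole rule each main term is `O(L′(1,χ)²/log²P)·(1/α) = O(α)` in the `𝔞𝔓` currency. Why it might fail: only if
the dipole upper bound for general `H¹` profiles (Lemma 8.2 is printed for polynomial × power weights) or Prop 7.1 for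
divisor-bounded data hides a compensating `log P`. [cite: Zhang2022LandauSiegel, §8 Lemma 8.1 Lemma 8.2 p.16, §7 Prop 7.1 p.13, §4 Lemma 4.8 p.9] -/
def TauTwoDarkShort (c' : ℝ) : Prop := CrossTablePsiOn c' ShortPairs 2 fun _ _ _ _ => 0

variable {c' : ℝ}

/-- Unfolding: darkness on short pairs is the bare estimate `‖τ₂‖ ≤ ε𝔞𝔓` eventually, for every short pair and every `ε > 0`.
[cite: Zhang2022LandauSiegel, §8 (8.5)] -/
theorem tauTwoDarkShort_iff : TauTwoDarkShort c' ↔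
    ∀ (f f' g g' : ℝ → ℂ), InClassPiece f f' → InClassPiece g g' → ShortPairs f f' g g' → ∀ ε : ℝ, 0 < ε →
      ForAllLarge fun D _ χ => AssumptionA D χ →
        ‖zDegMeanPsi c' χ 2 (fun x t => conj (profPoly χ x g (⌊bigP D⌋₊ + 1) t))
            (fun x t => profPoly χ x f (⌊bigP D⌋₊ + 1) t)‖ ≤ ε * frakA χ * frakP D := by
  unfold TauTwoDarkShort CrossTablePsiOn
  simp only [zero_mul, sub_zero, Nat.cast_ofNat]

/-- **What darkness pins:** if the route's full degree-2 slot `TauTwoTablePsi c' X₂` holds for some functional `X₂`, the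
table is dark on short pairs, and (A)-characters recur, then `X₂` VANISHES on every short in-class pair — so an instance
`E₀` of the closed-form tables built for a short design must have `E₀.X₂psiDiag = 0` there (display #1's `x₂ = []` with
the tag «derived = 0»). [cite: Zhang2022LandauSiegel, §8 (8.5), Lemma 8.1 p.16] -/
theorem eq_zero_of_tauTwoDarkShort {X₂ : PairFunctional} (h : TauTwoTablePsi c' X₂) (hd : TauTwoDarkShort c')
    (hA : ¬ ForAllLarge fun D _ χ => ¬ AssumptionA D χ) {f f' g g' : ℝ → ℂ} (hf : InClassPiece f f')
    (hg : InClassPiece g g') (hs : ShortPairs f f' g g') : X₂ f f' g g' = 0 :=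
  crossTablePsiOn_unique (h.on ShortPairs) hd hA hf hg hs

/-- Conversely, on the vacuous horn (¬(A) for all large `D`) darkness on short pairs — like every slot — holds for free.
[cite: Zhang2022LandauSiegel, §8 (8.5)] -/
theorem tauTwoDarkShort_of_notAEventually (hA : ForAllLarge fun D _ χ => ¬ AssumptionA D χ) :
    TauTwoDarkShort c' :=
  fun _ _ _ _ _ _ _ _ _ => hA.mono fun _ _ _ _ _ h hA' => absurd hA' h

end Short

end Literature.NumberTheory.LFunctions.Zhang2022.KnifeEdge

end
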